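import Mathlib
import HarnessLib
import Summits.NavierStokesRegularity.NavierStokesRegularity.Theorems.UnthreadedDoorNetFluxEnvelopeFacts
import Summits.NavierStokesRegularity.NavierStokesRegularity.Theorems.UnthreadedDoorNetFluxGrowthCap
import Summits.NavierStokesRegularity.NavierStokesRegularity.Theorems.UnthreadedDoorNetFluxNearCentreComparison

/-!
# Route `UnthreadedDoor`, crux `PoloidalLiouville` (stmt-NavierStokesRegularity-1222), WALL W1 `stub_scalarLiouville` —
# crux idea «netflux-typei-gap» (ns-idea-14, LINE v5): NF-1cᵛ support — THE LAPLACIAN AT A SPHERICAL EXTREMUM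

KEY-NS #156/#157 (director-ns g16; author ns-idea-14, «NETFLUX LINE v5» bcd4955f0879, derivation of (L) for `stub_oneSidedLaw_of_hinges`):
"`ΔT = T_rr + (2/r)T_r + r⁻²Δ_S T` with `Δ_S T ≤ 0` at a max (`≥ 0` at a min; Hessian along two great circles,
`InnerProductSpace.laplacian_eq_iteratedFDeriv_orthonormalBasis`)".  This file proves exactly that step, in the line's vocabulary:
for `f` smooth off `x₀`, `r > 0` and `x ∈ argmax_{S_r(x₀)} f`,
`Δ f (x) ≤ radDeriv2 f x₀ x + (2/r) · radDeriv f x₀ x`,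
and the reverse inequality at `x ∈ argmin_{S_r(x₀)} f`.  PROOF: complete the unit radial vector `u = (x − x₀)/r` to an orthonormal
basis `(u, e₁, e₂)` of `ℝ³` (`e₂ = u × e₁`); the Laplacian is the sum of the three second directional derivatives; `D²f(x)[u,u]` is the
second radial derivative (`radDeriv2_eq_fderiv_fderiv`, p664045); for a unit tangent `e ⊥ u` the great circle
`θ ↦ x₀ + r cos θ · u + r sin θ · e` stays on `S_r(x₀)`, so `h(θ) = f(γ(θ))` has a maximum at `θ = 0`, whence
`0 ≥ h''(0) = r² D²f(x)[e,e] − r Df(x)[u]`, i.e. `D²f(x)[e,e] ≤ radDeriv f x₀ x / r`.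

* `deriv_deriv_nonpos_of_isLocalMax` — `h'' (0) ≤ 0` at a local maximum of a function with `HasDerivAt` data near `0`;
* `fderiv_fderiv_tangent_le_of_mem_sphArgmax` — `D²f(x)[e,e] ≤ r⁻¹ Df(x)[u]` for a unit tangent `e` at a spherical maximiser;
* `fderiv_unitTangent_eq_zero_of_mem_sphArgmax`, `fderiv_eq_inner_mul_radDeriv_of_mem_sphArgmax` / `…sphArgmin` — at a spherical
  extremiser the derivative is RADIAL: `Df(x)[w] = ⟪w,u⟫ ∂_r f(x)`;
* `slice_identity_of_radial` — the SLICE IDENTITY `L = ⟪v,∇T⟫ − ∂_rP/r` from the head relation `L(x − x₀) = ⟪v,x − x₀⟫∇T − ∇P`;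
* `laplacian_le_of_mem_sphArgmax` — **`Δ f x ≤ radDeriv2 f x₀ x + (2/r) radDeriv f x₀ x` at a spherical maximiser**;
* `le_laplacian_of_mem_sphArgmin` — the mirror inequality at a spherical minimiser;
* `sphInf_eq_of_mem_sphArgmin`, `netFlux_sub_netFlux_le_of_extremisers` — the TIME COMPARISON at the extremisers (first line of (L)):
  `w_f − w_g ≤ r{[f − g](x̂⁺) − [f − g](x̂⁻)}`.

WHAT THIS IS NOT: no NS-regularity statement is touched (frozen-time calculus at one point); a SUPPORT lemma for the line's NF-1cᵛ
stub `stub_oneSidedLaw_of_hinges`, which stays OPEN; `PoloidalLiouville` (1222), W1, the line's rung target and the summit stay OPEN.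
`--supports stmt-NavierStokesRegularity-1222 --as helper`.  [folklore]
-/

noncomputable section

-- the summit and its single sub-problem share the name (CONVENTIONS §1)
set_option linter.dupNamespace false

open Set Function Filter Topology InnerProductSpace MeasureTheory
open scoped RealInnerProductSpace ContDiff

namespace Summit.NavierStokesRegularity.NavierStokesRegularity.Theorems.PoloidalLiouville.NetFlux

open Literature.Analysis Literature.Analysis.FluidPDE

/-! ### `h''(0) ≤ 0` at a local maximum -/

/-- **Second-order necessary condition at a local maximum**: if `h` has a local maximum at `a`, has derivative `h₁ θ` at every
`θ` near `a`, and `h₁` has derivative `h₂` at `a`, then `h₂ ≤ 0` (else the second-derivative test makes `a` a strict-side local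
minimum, so `h` is locally constant and `h₂ = 0`). [folklore] -/
theorem deriv_deriv_nonpos_of_isLocalMax {h h₁ : ℝ → ℝ} {h₂ a : ℝ} (hmax : IsLocalMax h a)
    (hd : ∀ᶠ θ in 𝓝 a, HasDerivAt h (h₁ θ) θ) (hd₂ : HasDerivAt h₁ h₂ a) : h₂ ≤ 0 := by
  by_contra hpos'
  have hpos : 0 < h₂ := not_le.1 hpos'
  have hda : HasDerivAt h (h₁ a) a := hd.self_of_nhds
  have hderiv : deriv h =ᶠ[𝓝 a] h₁ := by
    filter_upwards [hd] with θ hθ using hθ.deriv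
  have hdd : deriv (deriv h) a = h₂ := by rw [hderiv.deriv_eq]; exact hd₂.deriv
  have h1 : deriv h a = 0 := hmax.deriv_eq_zero
  have hmin : IsLocalMin h a := isLocalMin_of_deriv_deriv_pos (by rw [hdd]; exact hpos) h1 hda.continuousAt
  -- `h` is locally constant, so `deriv h = 0` near `a` and `deriv (deriv h) a = 0`
  have hconst : ∀ᶠ θ in 𝓝 a, h θ = h a := by
    filter_upwards [hmax, hmin] with θ h₁θ h₂θ using le_antisymm h₁θ h₂θ
  obtain ⟨δ, hδ, hball⟩ := Metric.eventually_nhds_iff.1 hconst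
  have hzero : deriv h =ᶠ[𝓝 a] fun _ => (0 : ℝ) := by
    filter_upwards [Metric.ball_mem_nhds a hδ] with θ hθ
    have hloc : h =ᶠ[𝓝 θ] fun _ => h a := by
      filter_upwards [Metric.isOpen_ball.mem_nhds hθ] with σ hσ using hball hσ
    rw [hloc.deriv_eq, deriv_const]
  have : deriv (deriv h) a = 0 := by rw [hzero.deriv_eq, deriv_const]
  rw [hdd] at this
  exact absurd this hpos.ne'

/-! ### The tangential second derivative at a spherical maximiser -/

variable {f : E3 → ℝ} {x₀ x : E3} {r : ℝ}

/-- **Tangential second derivatives at a spherical maximiser**: for `f` smooth off `x₀`, `r > 0`, `x ∈ argmax_{S_r(x₀)} f` with unit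
radial vector `u = r⁻¹(x − x₀)`, and a unit `e ⊥ u`: `D²f(x)[e,e] ≤ r⁻¹ · Df(x)[u]` (the great circle `x₀ + r cos θ·u + r sin θ·e`
stays on the sphere, so `θ ↦ f` along it is maximal at `θ = 0`). [folklore] -/
theorem fderiv_fderiv_tangent_le_of_mem_sphArgmax (hr : 0 < r) (hf : ContDiffOn ℝ (⊤ : ℕ∞) f ({x₀}ᶜ))
    (hx : x ∈ sphArgmax f x₀ r) {e : E3} (he : ‖e‖ = 1) (heu : ⟪e, r⁻¹ • (x - x₀)⟫ = 0) :
    fderiv ℝ (fderiv ℝ f) x e e ≤ r⁻¹ * fderiv ℝ f x (r⁻¹ • (x - x₀)) := by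
  have hO : IsOpen ({x₀}ᶜ : Set E3) := isOpen_compl_singleton
  have hxS : x ∈ Metric.sphere x₀ r := sphArgmax_subset_sphere _ _ _ hx
  have hxn : ‖x - x₀‖ = r := mem_sphere_iff_norm.1 hxS
  obtain ⟨u, hu⟩ : ∃ u : E3, u = r⁻¹ • (x - x₀) := ⟨_, rfl⟩
  rw [← hu] at heu ⊢
  have hu1 : ‖u‖ = 1 := by rw [hu, norm_smul, norm_inv, Real.norm_of_nonneg hr.le, hxn, inv_mul_cancel₀ hr.ne']
  have hxu : x₀ + r • u = x := by rw [hu, smul_smul, mul_inv_cancel₀ hr.ne', one_smul, add_sub_cancel]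
  have huu : ⟪u, u⟫ = 1 := by rw [real_inner_self_eq_norm_sq, hu1, one_pow]
  have hee : ⟪e, e⟫ = 1 := by rw [real_inner_self_eq_norm_sq, he, one_pow]
  have hue : ⟪u, e⟫ = 0 := by rw [real_inner_comm]; exact heu
  -- differentiability off the centre
  have hfd : ∀ y : E3, y ≠ x₀ → DifferentiableAt ℝ f y := fun y hy =>
    (hf.differentiableOn (by simp) y hy).differentiableAt (hO.mem_nhds hy)
  have hf2 : ContDiffOn ℝ (⊤ : ℕ∞) (fderiv ℝ f) ({x₀}ᶜ) := hf.fderiv_of_isOpen hO (by simp)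
  have hf2d : ∀ y : E3, y ≠ x₀ → DifferentiableAt ℝ (fderiv ℝ f) y := fun y hy =>
    (hf2.differentiableOn (by simp) y hy).differentiableAt (hO.mem_nhds hy)
  -- the great circle
  set γ : ℝ → E3 := fun θ => x₀ + (r * Real.cos θ) • u + (r * Real.sin θ) • e with hγ
  set γ₁ : ℝ → E3 := fun θ => (-(r * Real.sin θ)) • u + (r * Real.cos θ) • e with hγ₁
  set γ₂ : ℝ → E3 := fun θ => (-(r * Real.cos θ)) • u + (-(r * Real.sin θ)) • e with hγ₂
  have hγd : ∀ θ, HasDerivAt γ (γ₁ θ) θ := by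
    intro θ
    have h1 : HasDerivAt (fun θ => x₀ + (r * Real.cos θ) • u) ((r * -Real.sin θ) • u) θ :=
      (((Real.hasDerivAt_cos θ).const_mul r).smul_const u).const_add x₀
    have h2 : HasDerivAt (fun θ => (r * Real.sin θ) • e) ((r * Real.cos θ) • e) θ :=
      ((Real.hasDerivAt_sin θ).const_mul r).smul_const e
    have h12 : HasDerivAt (fun θ => x₀ + (r * Real.cos θ) • u + (r * Real.sin θ) • e)
        ((r * -Real.sin θ) • u + (r * Real.cos θ) • e) θ := h1.add h2
    refine h12.congr_deriv ?_
    simp only [hγ₁, mul_neg]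
  have hγ₁d : ∀ θ, HasDerivAt γ₁ (γ₂ θ) θ := by
    intro θ
    have h1 : HasDerivAt (fun θ => (-(r * Real.sin θ)) • u) ((-(r * Real.cos θ)) • u) θ :=
      ((Real.hasDerivAt_sin θ).const_mul r).neg.smul_const u
    have h2 : HasDerivAt (fun θ => (r * Real.cos θ) • e) ((r * -Real.sin θ) • e) θ :=
      ((Real.hasDerivAt_cos θ).const_mul r).smul_const e
    have h12 : HasDerivAt (fun θ => (-(r * Real.sin θ)) • u + (r * Real.cos θ) • e)
        ((-(r * Real.cos θ)) • u + (r * -Real.sin θ) • e) θ := h1.add h2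
    refine h12.congr_deriv ?_
    simp only [hγ₂, mul_neg]
  -- it stays on the sphere
  have hγS : ∀ θ, γ θ ∈ Metric.sphere x₀ r := by
    intro θ
    rw [mem_sphere_iff_norm]
    have e1 : γ θ - x₀ = (r * Real.cos θ) • u + (r * Real.sin θ) • e := by simp only [hγ]; abel
    have hsq : ‖γ θ - x₀‖ ^ 2 = r ^ 2 := by
      rw [e1, norm_add_sq_real]
      simp only [norm_smul, hu1, he, mul_one, real_inner_smul_left, real_inner_smul_right, hue, mul_zero, add_zero,
        Real.norm_eq_abs, sq_abs]
      have := Real.cos_sq_add_sin_sq θ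
      linear_combination r ^ 2 * this
    have h0 : 0 ≤ ‖γ θ - x₀‖ := norm_nonneg _
    nlinarith [hsq, hr]
  have hγne : ∀ θ, γ θ ≠ x₀ := fun θ => ne_center_of_mem_sphere hr (hγS θ)
  have hγ0 : γ 0 = x := by simp only [hγ, Real.cos_zero, Real.sin_zero, mul_one, mul_zero, zero_smul, add_zero]; exact hxu
  -- `h = f ∘ γ` is maximal at `0`
  set h : ℝ → ℝ := fun θ => f (γ θ) with hh
  have hmax : IsLocalMax h 0 := Filter.Eventually.of_forall fun θ => by
    show f (γ θ) ≤ f (γ 0)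
    rw [hγ0]
    exact hx.2 _ (hγS θ)
  -- first and second derivative of `h`
  set h₁ : ℝ → ℝ := fun θ => fderiv ℝ f (γ θ) (γ₁ θ) with hh₁
  have hhd : ∀ θ, HasDerivAt h (h₁ θ) θ := fun θ =>
    (hfd _ (hγne θ)).hasFDerivAt.comp_hasDerivAt θ (hγd θ)
  have hc : HasDerivAt (fun θ => fderiv ℝ f (γ θ)) (fderiv ℝ (fderiv ℝ f) (γ 0) (γ₁ 0)) 0 :=
    (hf2d _ (hγne 0)).hasFDerivAt.comp_hasDerivAt 0 (hγd 0)
  have hh₁d : HasDerivAt h₁ (fderiv ℝ (fderiv ℝ f) (γ 0) (γ₁ 0) (γ₁ 0) + fderiv ℝ f (γ 0) (γ₂ 0)) 0 :=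
    hc.clm_apply (hγ₁d 0)
  have hle := deriv_deriv_nonpos_of_isLocalMax hmax (Filter.Eventually.of_forall hhd) hh₁d
  -- evaluate at `θ = 0`
  have hγ₁0 : γ₁ 0 = r • e := by simp only [hγ₁, Real.cos_zero, Real.sin_zero, mul_one, mul_zero, neg_zero, zero_smul, zero_add]
  have hγ₂0 : γ₂ 0 = -(r • u) := by
    simp only [hγ₂, Real.cos_zero, Real.sin_zero, mul_one, mul_zero, neg_zero, zero_smul, add_zero, neg_smul]
  rw [hγ0, hγ₁0, hγ₂0, map_neg, map_smul, map_smul, _root_.smul_apply, map_smul, smul_eq_mul, smul_eq_mul, smul_eq_mul] at hle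
  -- `hle : r * (r * D²f[e,e]) + -(r * Df[u]) ≤ 0`
  have hr2 : 0 < r := hr
  have key : r * fderiv ℝ (fderiv ℝ f) x e e ≤ fderiv ℝ f x u := by nlinarith
  calc fderiv ℝ (fderiv ℝ f) x e e = r⁻¹ * (r * fderiv ℝ (fderiv ℝ f) x e e) := by
        rw [← mul_assoc, inv_mul_cancel₀ hr.ne', one_mul]
    _ ≤ r⁻¹ * fderiv ℝ f x u := mul_le_mul_of_nonneg_left key (inv_nonneg.2 hr.le)

/-! ### First-order conditions at a spherical extremum and the slice identity -/

/-- **Tangential derivatives vanish at a spherical maximiser** (unit tangent): for `f` differentiable at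
`x ∈ argmax_{S_r(x₀)} f`, `r > 0`, and a unit `e ⊥ (x − x₀)`: `Df(x)[e] = 0` (Fermat along the great circle). [folklore] -/
theorem fderiv_unitTangent_eq_zero_of_mem_sphArgmax (hr : 0 < r) (hf : DifferentiableAt ℝ f x)
    (hx : x ∈ sphArgmax f x₀ r) {e : E3} (he : ‖e‖ = 1) (heu : ⟪e, r⁻¹ • (x - x₀)⟫ = 0) :
    fderiv ℝ f x e = 0 := by
  have hxS : x ∈ Metric.sphere x₀ r := sphArgmax_subset_sphere _ _ _ hx
  have hxn : ‖x - x₀‖ = r := mem_sphere_iff_norm.1 hxS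
  obtain ⟨u, hu⟩ : ∃ u : E3, u = r⁻¹ • (x - x₀) := ⟨_, rfl⟩
  rw [← hu] at heu
  have hu1 : ‖u‖ = 1 := by rw [hu, norm_smul, norm_inv, Real.norm_of_nonneg hr.le, hxn, inv_mul_cancel₀ hr.ne']
  have hxu : x₀ + r • u = x := by rw [hu, smul_smul, mul_inv_cancel₀ hr.ne', one_smul, add_sub_cancel]
  have hue : ⟪u, e⟫ = 0 := by rw [real_inner_comm]; exact heu
  set γ : ℝ → E3 := fun θ => x₀ + (r * Real.cos θ) • u + (r * Real.sin θ) • e with hγ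
  have hγd : HasDerivAt γ ((r * -Real.sin 0) • u + (r * Real.cos 0) • e) 0 := by
    have h1 : HasDerivAt (fun θ => x₀ + (r * Real.cos θ) • u) ((r * -Real.sin 0) • u) 0 :=
      (((Real.hasDerivAt_cos 0).const_mul r).smul_const u).const_add x₀
    have h2 : HasDerivAt (fun θ => (r * Real.sin θ) • e) ((r * Real.cos 0) • e) 0 :=
      ((Real.hasDerivAt_sin 0).const_mul r).smul_const e
    have h12 : HasDerivAt (fun θ => x₀ + (r * Real.cos θ) • u + (r * Real.sin θ) • e)
        ((r * -Real.sin 0) • u + (r * Real.cos 0) • e) 0 := h1.add h2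
    exact h12
  have hγS : ∀ θ, γ θ ∈ Metric.sphere x₀ r := by
    intro θ
    rw [mem_sphere_iff_norm]
    have e1 : γ θ - x₀ = (r * Real.cos θ) • u + (r * Real.sin θ) • e := by simp only [hγ]; abel
    have hsq : ‖γ θ - x₀‖ ^ 2 = r ^ 2 := by
      rw [e1, norm_add_sq_real]
      simp only [norm_smul, hu1, he, mul_one, real_inner_smul_left, real_inner_smul_right, hue, mul_zero, add_zero,
        Real.norm_eq_abs, sq_abs]
      have := Real.cos_sq_add_sin_sq θ
      linear_combination r ^ 2 * this
    have h0 : 0 ≤ ‖γ θ - x₀‖ := norm_nonneg _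
    nlinarith [hsq, hr]
  have hγ0 : γ 0 = x := by simp only [hγ, Real.cos_zero, Real.sin_zero, mul_one, mul_zero, zero_smul, add_zero]; exact hxu
  have hmax : IsLocalMax (fun θ => f (γ θ)) 0 := Filter.Eventually.of_forall fun θ => by
    show f (γ θ) ≤ f (γ 0)
    rw [hγ0]
    exact hx.2 _ (hγS θ)
  have hfγ : DifferentiableAt ℝ f (γ 0) := by rw [hγ0]; exact hf
  have hh : HasDerivAt (fun θ => f (γ θ)) (fderiv ℝ f (γ 0) ((r * -Real.sin 0) • u + (r * Real.cos 0) • e)) 0 :=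
    hfγ.hasFDerivAt.comp_hasDerivAt 0 hγd
  have h0 := hmax.hasDerivAt_eq_zero hh
  rw [hγ0, Real.sin_zero, Real.cos_zero, neg_zero, mul_zero, zero_smul, zero_add, mul_one, map_smul, smul_eq_mul] at h0
  exact (mul_eq_zero.1 h0).resolve_left hr.ne'

/-- **At a spherical maximiser the derivative is radial**: `Df(x)[w] = ⟪w, u⟫ · ∂_r f(x)` for every `w`, `u = r⁻¹(x − x₀)`
(tangential part zero, radial part `radDeriv`). [folklore] -/
theorem fderiv_eq_inner_mul_radDeriv_of_mem_sphArgmax (hr : 0 < r) (hf : DifferentiableAt ℝ f x)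
    (hx : x ∈ sphArgmax f x₀ r) (w : E3) :
    fderiv ℝ f x w = ⟪w, r⁻¹ • (x - x₀)⟫ * radDeriv f x₀ x := by
  have hxS : x ∈ Metric.sphere x₀ r := sphArgmax_subset_sphere _ _ _ hx
  have hxne : x ≠ x₀ := ne_center_of_mem_sphere hr hxS
  have hxn : ‖x - x₀‖ = r := mem_sphere_iff_norm.1 hxS
  obtain ⟨u, hu⟩ : ∃ u : E3, u = r⁻¹ • (x - x₀) := ⟨_, rfl⟩
  rw [← hu]
  have hu1 : ‖u‖ = 1 := by rw [hu, norm_smul, norm_inv, Real.norm_of_nonneg hr.le, hxn, inv_mul_cancel₀ hr.ne']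
  have huu : ⟪u, u⟫ = 1 := by rw [real_inner_self_eq_norm_sq, hu1, one_pow]
  have hux : ‖x - x₀‖⁻¹ • (x - x₀) = u := by rw [hxn, hu]
  have hrad : radDeriv f x₀ x = fderiv ℝ f x u := by rw [radDeriv_eq_fderiv hxne hf, hux]
  -- tangential part
  set τ : E3 := w - ⟪w, u⟫ • u with hτ
  have hτu : ⟪τ, u⟫ = 0 := by rw [hτ, inner_sub_left, real_inner_smul_left, huu, mul_one, sub_self]
  have hτ0 : fderiv ℝ f x τ = 0 := by
    by_cases hz : τ = 0
    · rw [hz, map_zero]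
    · have hn : ‖τ‖ ≠ 0 := norm_ne_zero_iff.2 hz
      have h1 : fderiv ℝ f x (‖τ‖⁻¹ • τ) = 0 := by
        refine fderiv_unitTangent_eq_zero_of_mem_sphArgmax hr hf hx ?_ ?_
        · rw [norm_smul, norm_inv, norm_norm, inv_mul_cancel₀ hn]
        · rw [← hu, real_inner_smul_left, hτu, mul_zero]
      rw [map_smul, smul_eq_mul] at h1
      exact (mul_eq_zero.1 h1).resolve_left (inv_ne_zero hn)
  have hw : w = ⟪w, u⟫ • u + τ := by rw [hτ]; abel
  calc fderiv ℝ f x w = fderiv ℝ f x (⟪w, u⟫ • u + τ) := by rw [← hw]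
    _ = ⟪w, u⟫ * fderiv ℝ f x u := by rw [map_add, map_smul, hτ0, add_zero, smul_eq_mul]
    _ = ⟪w, u⟫ * radDeriv f x₀ x := by rw [hrad]

/-- **At a spherical minimiser the derivative is radial** (the max statement for `−f`). [folklore] -/
theorem fderiv_eq_inner_mul_radDeriv_of_mem_sphArgmin (hr : 0 < r) (hf : DifferentiableAt ℝ f x)
    (hx : x ∈ sphArgmin f x₀ r) (w : E3) :
    fderiv ℝ f x w = ⟪w, r⁻¹ • (x - x₀)⟫ * radDeriv f x₀ x := by
  rw [sphArgmin_eq_sphArgmax_neg] at hx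
  have hf' : DifferentiableAt ℝ (fun y => -f y) x := hf.neg
  have h := fderiv_eq_inner_mul_radDeriv_of_mem_sphArgmax (f := fun y => -f y) hr hf' hx w
  have e1 : fderiv ℝ (fun y => -f y) x w = -fderiv ℝ f x w := by
    have h2 : fderiv ℝ (-f) x = -fderiv ℝ f x := (hf.hasFDerivAt.neg).fderiv
    have h3 : (fun y => -f y) = -f := rfl
    rw [h3, h2]; rfl
  rw [e1, radDeriv_neg] at h
  linarith

/-- **The slice identity at a spherical extremum**: if at a point `x ∈ S_r(x₀)` the derivative of `T` is radial
(`DT(x)[w] = ⟪w,u⟫ ∂_rT(x)`, as at a spherical extremiser) and the head relation `L·(x − x₀) = ⟪v, x − x₀⟫ ∇T(x) − ∇P(x)` holds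
with `P` differentiable at `x`, then `L = ⟪v, ∇T(x)⟫ − ∂_r P(x)/r` — with `L = ∂_tT + ⟪v,∇T⟫ − ΔT` this is
`∂_tT = ΔT − ∂_rP/r` EXACTLY. [folklore] -/
theorem slice_identity_of_radial {T P : E3 → ℝ} {x₀ x vx : E3} {r L : ℝ} (hr : 0 < r) (hxS : x ∈ Metric.sphere x₀ r)
    (hP : DifferentiableAt ℝ P x)
    (hrad : ∀ w : E3, fderiv ℝ T x w = ⟪w, r⁻¹ • (x - x₀)⟫ * radDeriv T x₀ x)
    (hhead : L • (x - x₀) = ⟪vx, x - x₀⟫ • gradient T x - gradient P x) :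
    L = ⟪vx, gradient T x⟫ - radDeriv P x₀ x / r := by
  have hxne : x ≠ x₀ := ne_center_of_mem_sphere hr hxS
  have hxn : ‖x - x₀‖ = r := mem_sphere_iff_norm.1 hxS
  obtain ⟨u, hu⟩ : ∃ u : E3, u = r⁻¹ • (x - x₀) := ⟨_, rfl⟩
  have hux : ‖x - x₀‖⁻¹ • (x - x₀) = u := by rw [hxn, hu]
  have hxu : x - x₀ = r • u := by rw [hu, smul_smul, mul_inv_cancel₀ hr.ne', one_smul]
  have hu1 : ‖u‖ = 1 := by rw [hu, norm_smul, norm_inv, Real.norm_of_nonneg hr.le, hxn, inv_mul_cancel₀ hr.ne']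
  have huu : ⟪u, u⟫ = 1 := by rw [real_inner_self_eq_norm_sq, hu1, one_pow]
  have hradP : radDeriv P x₀ x = fderiv ℝ P x u := by rw [radDeriv_eq_fderiv hxne hP, hux]
  have hgT : ∀ w : E3, ⟪gradient T x, w⟫ = fderiv ℝ T x w := fun w => by
    rw [gradient, InnerProductSpace.toDual_symm_apply]
  have hgP : ∀ w : E3, ⟪gradient P x, w⟫ = fderiv ℝ P x w := fun w => by
    rw [gradient, InnerProductSpace.toDual_symm_apply]
  -- inner product of the head relation with `u`
  rw [hxu] at hhead
  have h := congrArg (fun z => ⟪z, u⟫) hhead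
  simp only [inner_sub_left, real_inner_smul_left, real_inner_smul_right, hgT, hgP, huu, mul_one] at h
  rw [hrad u, ← hu, huu, one_mul] at h
  -- `h : L * r = r * ⟪vx, u⟫ * radDeriv T x₀ x - fderiv ℝ P x u`
  have hvT : ⟪vx, gradient T x⟫ = ⟪vx, u⟫ * radDeriv T x₀ x := by
    rw [real_inner_comm, hgT, hrad vx, ← hu]
  rw [hvT, hradP]
  have key : L * r = r * ⟪vx, u⟫ * radDeriv T x₀ x - fderiv ℝ P x u := by linarith [h]
  field_simp
  linarith [key]

/-! ### An orthonormal frame adapted to the radial direction -/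

/-- **A radial orthonormal frame**: for a unit vector `u ∈ ℝ³` there are `e₁, e₂` with `(u, e₁, e₂)` orthonormal, packaged as an
orthonormal basis `b` of `ℝ³` with `b 0 = u`. [folklore] -/
theorem exists_orthonormalBasis_radial {u : E3} (hu : ‖u‖ = 1) :
    ∃ b : OrthonormalBasis (Fin 3) ℝ E3, b 0 = u ∧ (∀ i, ‖b i‖ = 1) ∧ ⟪b 1, u⟫ = 0 ∧ ⟪b 2, u⟫ = 0 := by
  obtain ⟨e₁, he₁, he₁u⟩ := exists_unit_orth u
  set e₂ : E3 := cross u e₁ with he₂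
  have hue₁ : ⟪u, e₁⟫ = 0 := by rw [real_inner_comm]; exact he₁u
  have he₂n : ‖e₂‖ = 1 := by rw [he₂, norm_cross_of_unit_orth hu hue₁, he₁]
  have he₂u : ⟪e₂, u⟫ = 0 := Tao2016.inner_cross_self_left u e₁
  have he₂e₁ : ⟪e₂, e₁⟫ = 0 := Tao2016.inner_cross_self_right u e₁
  have hue₂ : ⟪u, e₂⟫ = 0 := by rw [real_inner_comm]; exact he₂u
  have he₁e₂ : ⟪e₁, e₂⟫ = 0 := by rw [real_inner_comm]; exact he₂e₁
  set v : Fin 3 → E3 := ![u, e₁, e₂] with hv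
  have hon : Orthonormal ℝ v := by
    rw [orthonormal_iff_ite]
    intro i j
    fin_cases i <;> fin_cases j <;>
      simp [hv, hu, he₁, he₂n, hue₁, he₁u, he₂u, he₂e₁, hue₂, he₁e₂]
  have hsp : ⊤ ≤ Submodule.span ℝ (Set.range v) := by
    rw [hon.linearIndependent.span_eq_top_of_card_eq_finrank (by simp)]
  refine ⟨OrthonormalBasis.mk hon hsp, ?_, ?_, ?_, ?_⟩
  · rw [OrthonormalBasis.coe_mk]; rfl
  · intro i; rw [OrthonormalBasis.coe_mk]; fin_cases i
    · exact hu
    · exact he₁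
    · exact he₂n
  · rw [OrthonormalBasis.coe_mk]; exact he₁u
  · rw [OrthonormalBasis.coe_mk]; exact he₂u

/-! ### The Laplacian at a spherical extremum -/

/-- **The Laplacian at a spherical maximiser**: for `f` smooth off `x₀`, `r > 0` and `x ∈ argmax_{S_r(x₀)} f`,
`Δ f (x) ≤ ∂_r² f(x) + (2/r) ∂_r f(x)` (`= radDeriv2 f x₀ x + (2/r) · radDeriv f x₀ x`): the spherical Laplacian is `≤ 0` at a
maximum of `f|_{S_r}`. [folklore] -/
theorem laplacian_le_of_mem_sphArgmax (hr : 0 < r) (hf : ContDiffOn ℝ (⊤ : ℕ∞) f ({x₀}ᶜ)) (hx : x ∈ sphArgmax f x₀ r) :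
    Laplacian.laplacian f x ≤ radDeriv2 f x₀ x + (2 / r) * radDeriv f x₀ x := by
  have hO : IsOpen ({x₀}ᶜ : Set E3) := isOpen_compl_singleton
  have hxS : x ∈ Metric.sphere x₀ r := sphArgmax_subset_sphere _ _ _ hx
  have hxne : x ≠ x₀ := ne_center_of_mem_sphere hr hxS
  have hxn : ‖x - x₀‖ = r := mem_sphere_iff_norm.1 hxS
  set u : E3 := r⁻¹ • (x - x₀) with hu
  have hu1 : ‖u‖ = 1 := by rw [hu, norm_smul, norm_inv, Real.norm_of_nonneg hr.le, hxn, inv_mul_cancel₀ hr.ne']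
  have hux : ‖x - x₀‖⁻¹ • (x - x₀) = u := by rw [hxn]
  have hfd : DifferentiableAt ℝ f x := (hf.differentiableOn (by simp) x hxne).differentiableAt (hO.mem_nhds hxne)
  -- radial derivatives
  have hrad1 : radDeriv f x₀ x = fderiv ℝ f x u := by rw [radDeriv_eq_fderiv hxne hfd, hux]
  have hrad2 : radDeriv2 f x₀ x = fderiv ℝ (fderiv ℝ f) x u u := by rw [radDeriv2_eq_fderiv_fderiv hxne hf, hux]
  -- the adapted frame and the Laplacian
  obtain ⟨b, hb0, hb1, hb1u, hb2u⟩ := exists_orthonormalBasis_radial hu1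
  have hΔ := congrFun (InnerProductSpace.laplacian_eq_iteratedFDeriv_orthonormalBasis f b) x
  simp only [Fin.sum_univ_three, iteratedFDeriv_two_apply, Matrix.cons_val_zero, Matrix.cons_val_one] at hΔ
  rw [hΔ, hb0, hrad1, hrad2]
  have h1 := fderiv_fderiv_tangent_le_of_mem_sphArgmax hr hf hx (hb1 1) hb1u
  have h2 := fderiv_fderiv_tangent_le_of_mem_sphArgmax hr hf hx (hb1 2) hb2u
  rw [← hu] at h1 h2
  have e : (2 / r) * fderiv ℝ f x u = r⁻¹ * fderiv ℝ f x u + r⁻¹ * fderiv ℝ f x u := by ring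
  rw [e]
  linarith

/-- **The Laplacian at a spherical minimiser**: for `f` smooth off `x₀`, `r > 0` and `x ∈ argmin_{S_r(x₀)} f`,
`∂_r² f(x) + (2/r) ∂_r f(x) ≤ Δ f (x)` (the sup statement for `−f`). [folklore] -/
theorem le_laplacian_of_mem_sphArgmin (hr : 0 < r) (hf : ContDiffOn ℝ (⊤ : ℕ∞) f ({x₀}ᶜ)) (hx : x ∈ sphArgmin f x₀ r) :
    radDeriv2 f x₀ x + (2 / r) * radDeriv f x₀ x ≤ Laplacian.laplacian f x := by
  rw [sphArgmin_eq_sphArgmax_neg] at hx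
  have h := laplacian_le_of_mem_sphArgmax hr hf.neg hx
  rw [radDeriv_neg, radDeriv2_neg] at h
  have e : Laplacian.laplacian (fun y => -f y) x = -Laplacian.laplacian f x :=
    congrFun (InnerProductSpace.laplacian_neg (f := f)) x
  rw [e] at h
  linarith

/-! ### Time comparison at the extremisers (first line of derivation (L)) -/

/-- `min_{S_r(x₀)} f = f xm` for a minimiser `xm`. [folklore] -/
theorem sphInf_eq_of_mem_sphArgmin {g : E3 → ℝ} {x₀ xm : E3} {r : ℝ} (hg : ContinuousOn g (Metric.sphere x₀ r))
    (hxm : xm ∈ sphArgmin g x₀ r) : sphInf g x₀ r = g xm := by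
  rw [sphArgmin_eq_sphArgmax_neg] at hxm
  have hg' : ContinuousOn (fun x => -g x) (Metric.sphere x₀ r) := hg.neg
  rw [sphInf_eq_neg_sphSup_neg, sphSup_eq_of_mem_sphArgmax hg' hxm, neg_neg]

/-- **Time comparison at the extremisers**: for `xp ∈ argmax_{S_r(x₀)} f`, `xm ∈ argmin_{S_r(x₀)} f`, `g` continuous on the sphere and
`r ≥ 0`: `netFlux f x₀ r − netFlux g x₀ r ≤ r · ((f xp − g xp) − (f xm − g xm))` (since `max g ≥ g xp`, `min g ≤ g xm`) — with `f = T(t)`,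
`g = T(t−h)` this is `w(t,r) − w(t−h,r) ≤ r{[T(t,x̂⁺) − T(t−h,x̂⁺)] − [T(t,x̂⁻) − T(t−h,x̂⁻)]}`. [folklore] -/
theorem netFlux_sub_netFlux_le_of_extremisers {f g : E3 → ℝ} {x₀ xp xm : E3} {r : ℝ} (hr : 0 ≤ r)
    (hf : ContinuousOn f (Metric.sphere x₀ r)) (hg : ContinuousOn g (Metric.sphere x₀ r))
    (hxp : xp ∈ sphArgmax f x₀ r) (hxm : xm ∈ sphArgmin f x₀ r) :
    netFlux f x₀ r - netFlux g x₀ r ≤ r * ((f xp - g xp) - (f xm - g xm)) := by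
  have h1 : sphSup f x₀ r = f xp := sphSup_eq_of_mem_sphArgmax hf hxp
  have h2 : sphInf f x₀ r = f xm := sphInf_eq_of_mem_sphArgmin hf hxm
  have h3 : g xp ≤ sphSup g x₀ r := le_sphSup hg (sphArgmax_subset_sphere _ _ _ hxp)
  have h4 : sphInf g x₀ r ≤ g xm := sphInf_le hg hxm.1
  unfold netFlux sphOsc
  rw [h1, h2]
  have h5 : r * (g xp - g xm) ≤ r * (sphSup g x₀ r - sphInf g x₀ r) := mul_le_mul_of_nonneg_left (by linarith) hr
  nlinarith [h5]

end Summit.NavierStokesRegularity.NavierStokesRegularity.Theorems.PoloidalLiouville.NetFlux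

end
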